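import Summits.ResolutionOfSingularities.ResolutionOfSingularities.Theorems.UniversalCellsCampaignW82KollarCurveAnyField
import Summits.ResolutionOfSingularities.ResolutionOfSingularities.Theorems.UniversalCellsCampaignW82KollarCurve
import HarnessLib

/-!
# [OURS · L1 W8.2] Kollár's curve over `k(t)`, ARBITRARY field `k` of characteristic `p`: the cusp after
# `t ↦ t^{1/p}`, geometric integrality, regularity of the whole ring, dimension one

Cell `res-hironaka`, LADDER-RESOLUTION rung L, slot W8.2 (host `UniversalCells.PrimeFieldToPerfect`, stmt-15233; door 2
`UniformComplexity.PrimeModelTransfer`, stmt-8933). Written by res-L1-s82-pv-1 (gen 3). Companion of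
Theorems/UniversalCellsCampaignW82KollarCurveAnyField.lean (objects; barrier §1 transcribed to `RatFunc k`): this file
transcribes the barrier entry's §2–§3 (`Literature.Barriers.ResolutionOfSingularities.RegularNotGeometricallyRegular`:
the cusp `kollarRingExt`, `not_isRegularLocalRing_cuspIdeal`, the base-change isomorphism `kollarRingExtEquiv`) and
re-runs the `𝔽_p(t)`-file Theorems/UniversalCellsCampaignW82KollarCurve.lean (§3–§5: `isDomain_tensor_kollarRing`,
`isRegularRing_kollarRing`, `ringKrullDim_kollarRing`) over `RatFunc k` for an arbitrary field `k` of characteristic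
`p`; the generic polynomial lemmas (`irreducible_X_sub_C_pow_sub_X_pow`, `isDomain_quotient_twist`,
`derivation_apply_mem_of_mem_sq`) are imported from that file, not repeated. Proofs are transcriptions (credit: the
barrier entry and the sibling file). Consumed by Theorems/UniversalCellsCampaignW82ExponentZeroAnyField.lean
(`¬ SmoothModelStepRegularAt k 1` for EVERY field `k` of characteristic `p` — door 1 at every perfect `M`, door 2 at
every algebraically closed `M`).

HONEST FRAMING. OURS support; mathematics = Kollár 2007, 1.19 / Liu 2002, Ex. 7.3.15 ("`k` any field of
characteristic `p`"); nothing here is a statement of H. Hironaka's manuscript [Hironaka2017], nothing attributed to its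
author. No `sorry`, no new axioms. AI work, weaker than expert review.

## References (locators)
* J. Kollár, *Lectures on Resolution of Singularities* (2007), 1.19. [Kollar2007]
* Q. Liu, *Algebraic Geometry and Arithmetic Curves* (2002), Ex. 7.3.15, Rem. 4.3.34. [Liu2002]
* R. Hartshorne, *Algebraic Geometry* (1977), I Thm. 5.1 (Jacobian criterion). [Hartshorne1977]
* H. Matsumura, *Commutative Ring Theory* (1986), Thm. 14.2. [Matsumura1987]
-/

noncomputable section

set_option linter.dupNamespace false -- mandated namespace of this single-conjunct summit

open Polynomial IsLocalRing TensorProduct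
open Literature.AlgebraicGeometry.Resolution
open Summit.ResolutionOfSingularities.ResolutionOfSingularities.Theorems.CampaignW82.KollarCurve
  (irreducible_X_sub_C_pow_sub_X_pow isDomain_quotient_twist derivation_apply_mem_of_mem_sq)

namespace Summit.ResolutionOfSingularities.ResolutionOfSingularities.Theorems.CampaignW82.KollarCurveAnyField

section Kollar

variable (k : Type) [Field k] (p : ℕ) [hp : Fact p.Prime] (q : ℕ) [hq : Fact (1 < q)]

/-! ## §2 After the base change `k(t) → K = k(t)(t^{1/p})`: the cusp `y^q = (x − t^{1/p})^p` (barrier §2, transcribed) -/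

/-- `f_K = Y^q − X^p + s^p ∈ K[X,Y]` (`s = t^{1/p}`), the image of `f`; `K[X,Y]/(f_K) = K ⊗ₖ A`
(`kollarRingExtEquiv`). [cite: Kollar2007, 1.19 (Curves over nonperfect fields)] -/
def kollarPolyExt : MvPolynomial (Fin 2) (extField k p) :=
  MvPolynomial.map (algebraMap (RatFunc k) (extField k p)) (kollarPoly k p q)

/-- The coordinate ring `A_K = K[X,Y]/(f_K)` of `C_K = C ×ₖ Spec K`. [cite: Kollar2007, 1.19
(Curves over nonperfect fields)] -/
abbrev kollarRingExt : Type := MvPolynomial (Fin 2) (extField k p) ⧸ Ideal.span {kollarPolyExt k p q}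

/-- The `K`-rational point `(t^{1/p}, 0)` of `C_K`. [cite: Kollar2007, 1.19 (Curves over
nonperfect fields)] -/
def cuspPt : Fin 2 → extField k p := ![AdjoinRoot.root (insepPoly k p), 0]

omit hq in
/-- `f_K = Y^q − X^p + t` with `t = s^p` now a `p`-th power. [folklore] -/
theorem kollarPolyExt_eq : kollarPolyExt k p q =
    MvPolynomial.X 1 ^ q - MvPolynomial.X 0 ^ p +
      MvPolynomial.C (algebraMap (RatFunc k) (extField k p) RatFunc.X) := by
  simp [kollarPolyExt, kollarPoly, MvPolynomial.map_X, MvPolynomial.map_C]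

/-- `f_K(s, 0) = 0`. [folklore] -/
theorem eval_cuspPt_kollarPolyExt : MvPolynomial.eval (cuspPt k p) (kollarPolyExt k p q) = 0 := by
  have hq0 : q ≠ 0 := by have := hq.out; omega
  rw [kollarPolyExt_eq]
  simp [cuspPt, root_pow_eq, zero_pow hq0]

/-- `∇f_K(s, 0) = 0`: `∂f_K/∂X = −p X^{p−1} = 0` identically (`p = 0` in `K`) and
`∂f_K/∂Y = q Y^{q−1}` vanishes at `Y = 0` (`q ≥ 2`). [cite: Kollar2007, 1.19 (Curves over
nonperfect fields)] -/
theorem eval_cuspPt_pderiv [CharP k p] (i : Fin 2) :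
    MvPolynomial.eval (cuspPt k p) (MvPolynomial.pderiv i (kollarPolyExt k p q)) = 0 := by
  have hq1 : q - 1 ≠ 0 := by have := hq.out; omega
  rw [kollarPolyExt_eq]
  fin_cases i
  · simp [cuspPt, Derivation.leibniz_pow]
  · simp [cuspPt, Derivation.leibniz_pow, zero_pow hq1]

omit hq in
/-- `f_K ≠ 0` (it takes the value `1` at `(s, 1)`). [folklore] -/
theorem kollarPolyExt_ne_zero : kollarPolyExt k p q ≠ 0 := by
  intro h
  have := congrArg (MvPolynomial.eval ![AdjoinRoot.root (insepPoly k p), 1]) h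
  rw [kollarPolyExt_eq] at this
  simp [root_pow_eq] at this

/-- `(f_K) ≤ 𝔪_{(s,0)} = ker (eval (s, 0))`. [folklore] -/
theorem span_kollarPolyExt_le :
    Ideal.span {kollarPolyExt k p q} ≤ RingHom.ker (MvPolynomial.eval (cuspPt k p)) :=
  (Ideal.span_singleton_le_iff_mem _).mpr (eval_cuspPt_kollarPolyExt k p q)

/-- The point `Q = (s, 0) ∈ C_K` as a prime of `A_K`. [cite: Kollar2007, 1.19 (Curves over
nonperfect fields)] -/
abbrev cuspIdeal : Ideal (kollarRingExt k p q) :=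
  (RingHom.ker (MvPolynomial.eval (cuspPt k p))).map (Ideal.Quotient.mk _)

/-- `ker (eval (s,0))` is prime. [folklore] -/
instance ker_eval_cuspPt_isPrime : (RingHom.ker (MvPolynomial.eval (cuspPt k p))).IsPrime :=
  RingHom.ker_isPrime _

/-- `Q` is prime. [folklore] -/
instance cuspIdeal_isPrime : (cuspIdeal k p q).IsPrime :=
  Literature.Barriers.ResolutionOfSingularities.isPrime_map_mk_of_le _ _ (span_kollarPolyExt_le k p q)

/-- The preimage of `Q` in `K[X,Y]` is `𝔪_{(s,0)}`. [folklore] -/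
theorem comap_cuspIdeal :
    (cuspIdeal k p q).comap (Ideal.Quotient.mk _) = RingHom.ker (MvPolynomial.eval (cuspPt k p)) :=
  Literature.Barriers.ResolutionOfSingularities.comap_map_mk_eq_of_le _ _ (span_kollarPolyExt_le k p q)

/-- **Kollár 2007, 1.19, second half (proved): `C_K` is singular at `Q`** — the local ring of
`A_K = K[X,Y]/(Y^q − (X − s)^p)` at `(s, 0)` is not a regular local ring (Jacobian criterion,
singular direction: `f_K` and both partials vanish at the `K`-point `(s, 0)`).
[cite: Kollar2007, 1.19 (Curves over nonperfect fields)] [cite: Hartshorne1977, I Thm. 5.1] -/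
theorem not_isRegularLocalRing_cuspIdeal [CharP k p] :
    ¬ IsRegularLocalRing (Localization.AtPrime (cuspIdeal k p q)) :=
  not_isRegularLocalRing_localization_of_pderiv_eval_eq_zero (cuspPt k p) (kollarPolyExt_ne_zero k p q)
    (eval_cuspPt_kollarPolyExt k p q) (eval_cuspPt_pderiv k p q) (cuspIdeal k p q) (comap_cuspIdeal k p q)

/-! ## §3 `A_K = K ⊗ A` (barrier §3, transcribed) -/

/-- `A_K = K[X,Y]/(f_K)` **is** the base change `K ⊗ₖ A`, as `K`-algebras (Mathlib's
`Algebra.TensorProduct.tensorQuotientEquiv` composed with `MvPolynomial.algebraTensorAlgEquiv`,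
which sends `1 ⊗ f` to `f_K`). [folklore] -/
def kollarRingExtEquiv :
    extField k p ⊗[RatFunc k] kollarRing k p q ≃ₐ[extField k p] kollarRingExt k p q :=
  (Algebra.TensorProduct.tensorQuotientEquiv (R := RatFunc k) (extField k p)
      (MvPolynomial (Fin 2) (RatFunc k)) (extField k p) (Ideal.span {kollarPoly k p q})).trans
    (Ideal.quotientEquivAlg _ _ (MvPolynomial.algebraTensorAlgEquiv (RatFunc k) (extField k p)) (by
      rw [Ideal.map_span, Set.image_singleton, Ideal.map_span, Set.image_singleton]
      congr 1
      ext1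
      simp [kollarPolyExt, Algebra.TensorProduct.includeRight_apply]))


/-! ## §4 Geometric integrality: `L ⊗ₖ A` is a domain whenever `t` is a `p`-th power in `L` -/

omit hq in
/-- Over a field `L ⊇ k = 𝔽_p(t)` in which `t = c^p`, the image of `f = Y^q − X^p + t` is
`−((X − c)^p − Y^q)` (Frobenius: `(X − c)^p = X^p − c^p`). [folklore] -/
theorem map_kollarPoly_eq [CharP k p] (L : Type) [Field L] [Algebra (RatFunc k) L] (c : L)
    (hc : c ^ p = algebraMap (RatFunc k) L RatFunc.X) :
    MvPolynomial.map (algebraMap (RatFunc k) L) (kollarPoly k p q) =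
      -((MvPolynomial.X 0 - MvPolynomial.C c) ^ p - MvPolynomial.X 1 ^ q) := by
  haveI : CharP L p := charP_of_injective_algebraMap (algebraMap (RatFunc k) L).injective p
  simp only [kollarPoly, map_sub, map_add, map_pow, MvPolynomial.map_X, MvPolynomial.map_C, ← hc]
  rw [sub_pow_char (MvPolynomial.X 0) (MvPolynomial.C c), ← MvPolynomial.C_pow]
  ring

omit hq in
/-- **The Kollár curve is geometrically integral at the relevant levels**: for every field
`L ⊇ k = 𝔽_p(t)` containing a `p`-th root of `t` (every purely inseparable level `k(t^{1/p^e})`,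
`e ≥ 1`, and every perfect field over `k`) and every exponent `q` prime to `p`,
`L ⊗ₖ k[X,Y]/(Y^q − X^p + t) ≅ L[X,Y]/((X − t^{1/p})^p − Y^q)` is a DOMAIN. This is the part of
Kollár 2007, 1.19 / Liu 2002, Ex. 7.3.15 ("geometrically integral") that the barrier entry
`RegularNotGeometricallyRegular` left unformalised (scope caveat (b)). [cite: Liu2002, Example 7.3.15 and Remark 4.3.34] -/
theorem isDomain_tensor_kollarRing [CharP k p] (hpq : ¬ p ∣ q) (L : Type) [Field L]
    [Algebra (RatFunc k) L]
    (c : L) (hc : c ^ p = algebraMap (RatFunc k) L RatFunc.X) :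
    IsDomain (L ⊗[RatFunc k] kollarRing k p q) := by
  -- `L ⊗ₖ (k[X,Y]/(f)) ≅ L[X,Y]/(f_L)`
  let e : L ⊗[RatFunc k] kollarRing k p q ≃ₐ[L]
      MvPolynomial (Fin 2) L ⧸ Ideal.span {MvPolynomial.map (algebraMap (RatFunc k) L) (kollarPoly k p q)} :=
    (Algebra.TensorProduct.tensorQuotientEquiv (R := RatFunc k) L
        (MvPolynomial (Fin 2) (RatFunc k)) L (Ideal.span {kollarPoly k p q})).trans
      (Ideal.quotientEquivAlg _ _ (MvPolynomial.algebraTensorAlgEquiv (RatFunc k) L) (by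
        rw [Ideal.map_span, Set.image_singleton, Ideal.map_span, Set.image_singleton]
        congr 1
        ext1
        simp [Algebra.TensorProduct.includeRight_apply]))
  rw [map_kollarPoly_eq k p q L c hc, Ideal.span_singleton_neg] at e
  haveI := isDomain_quotient_twist L c hp.out hpq
  exact e.toMulEquiv.isDomain _

/-! ## §5 Regularity of `A = k[X,Y]/(Y^q − X^p + t)` at every prime (for `p ∤ q`) -/

omit hp hq in
/-- At a prime `Q ∌ Y` of `k[X,Y]` containing `f = Y^q − X^p + t` (`p ∤ q`), `f ∉ Q^{(2)}`:
otherwise `∂f/∂Y = q Y^{q−1} ∈ Q`. [folklore] -/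
theorem kollarPoly_not_mem_sq [CharP k p] (hpq : ¬ p ∣ q) (Q : Ideal (MvPolynomial (Fin 2) (RatFunc k)))
    [Q.IsPrime] (hY : MvPolynomial.X 1 ∉ Q) :
    algebraMap _ (Localization.AtPrime Q) (kollarPoly k p q) ∉ (maximalIdeal _) ^ 2 := by
  intro h
  rw [← Localization.AtPrime.map_eq_maximalIdeal, ← Ideal.map_pow,
    IsLocalization.mem_map_algebraMap_iff Q.primeCompl] at h
  obtain ⟨⟨⟨i, hi⟩, ⟨s, hs⟩⟩, h⟩ := h
  simp only at h
  rw [← map_mul] at h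
  have hinj : Function.Injective (algebraMap (MvPolynomial (Fin 2) (RatFunc k)) (Localization.AtPrime Q)) :=
    IsLocalization.injective _ Q.primeCompl_le_nonZeroDivisors
  have hmem : kollarPoly k p q * s ∈ Q ^ 2 := by rw [hinj h]; exact hi
  -- apply `∂/∂Y`
  have hD := derivation_apply_mem_of_mem_sq (MvPolynomial.pderiv 1) Q hmem
  have hfQ : kollarPoly k p q ∈ Q := by
    have := Ideal.pow_le_self two_ne_zero hmem
    exact ((Ideal.IsPrime.mem_or_mem ‹_› this).resolve_right hs)
  rw [Derivation.leibniz, smul_eq_mul, smul_eq_mul] at hD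
  have h2 : s * MvPolynomial.pderiv 1 (kollarPoly k p q) ∈ Q := by
    have h3 : kollarPoly k p q * MvPolynomial.pderiv 1 s ∈ Q := Q.mul_mem_right _ hfQ
    simpa using (Submodule.sub_mem _ hD h3)
  have h4 : MvPolynomial.pderiv 1 (kollarPoly k p q) ∈ Q :=
    ((Ideal.IsPrime.mem_or_mem ‹_› h2).resolve_left hs)
  have hder : MvPolynomial.pderiv 1 (kollarPoly k p q) =
      (q : MvPolynomial (Fin 2) (RatFunc k)) * MvPolynomial.X 1 ^ (q - 1) := by
    have h01 : (0 : Fin 2) ≠ 1 := by decide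
    simp only [kollarPoly, map_add, map_sub, Derivation.leibniz_pow, MvPolynomial.pderiv_X_self,
      MvPolynomial.pderiv_X_of_ne h01, MvPolynomial.pderiv_C, mul_zero, sub_zero, add_zero,
      smul_eq_mul, mul_one, nsmul_eq_mul]
  rw [hder] at h4
  have hqK : (q : RatFunc k) ≠ 0 := by
    intro h0
    exact hpq ((CharP.cast_eq_zero_iff (RatFunc k) p q).mp h0)
  have hunit : IsUnit (q : MvPolynomial (Fin 2) (RatFunc k)) := by
    rw [← map_natCast (MvPolynomial.C (σ := Fin 2) (R := RatFunc k)) q]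
    exact (isUnit_iff_ne_zero.mpr hqK).map _
  rw [Ideal.unit_mul_mem_iff_mem _ hunit] at h4
  exact hY (Ideal.IsPrime.mem_of_pow_mem ‹_› _ h4)

/-- A prime of `A = k[X,Y]/(f)` containing `ȳ` is the point `𝔭 = (X^p − t, Y)/(f)`: the quotient
map `k[X,Y] → A/𝔮` kills `Y` and `X^p − t = Y^q − f`, hence factors through
`k[X,Y] → k(t^{1/p})`, `X ↦ t^{1/p}`, `Y ↦ 0`, whose kernel is `𝔮₀ = (X^p − t, Y)`. [folklore] -/
theorem eq_kollarPoint_of_mem (Q : Ideal (kollarRing k p q)) [Q.IsPrime]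
    (hY : Ideal.Quotient.mk _ (MvPolynomial.X 1) ∈ Q) : Q = kollarPoint k p q := by
  have hq0 : q ≠ 0 := by have := hq.out; omega
  -- `ψ : k[X,Y] → A/Q`
  let ψ : MvPolynomial (Fin 2) (RatFunc k) →ₐ[RatFunc k] kollarRing k p q ⧸ Q :=
    (Ideal.Quotient.mkₐ (RatFunc k) Q).comp
      (Ideal.Quotient.mkₐ (RatFunc k) (Ideal.span {kollarPoly k p q}))
  have hψY : ψ (MvPolynomial.X 1) = 0 := by
    simpa [ψ] using (Ideal.Quotient.eq_zero_iff_mem.mpr hY)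
  have hψf : ψ (kollarPoly k p q) = 0 := by
    simp only [ψ, AlgHom.comp_apply, Ideal.Quotient.mkₐ_eq_mk,
      Ideal.Quotient.eq_zero_iff_mem.mpr (Ideal.subset_span rfl : kollarPoly k p q ∈ Ideal.span {kollarPoly k p q}),
      map_zero]
  have hψX : (ψ (MvPolynomial.X 0)) ^ p =
      (algebraMap (RatFunc k) (kollarRing k p q ⧸ Q) : RatFunc k →+* kollarRing k p q ⧸ Q)
        RatFunc.X := by
    have h1 : ψ (MvPolynomial.X 0 ^ p - MvPolynomial.C RatFunc.X) = 0 := by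
      have : MvPolynomial.X 0 ^ p - MvPolynomial.C RatFunc.X =
          MvPolynomial.X 1 ^ q - kollarPoly k p q := by rw [kollarPoly]; ring
      rw [this, map_sub, hψf, sub_zero, map_pow, hψY]
      exact zero_pow (M₀ := kollarRing k p q ⧸ Q) hq0
    rw [map_sub, map_pow, MvPolynomial.algHom_C, sub_eq_zero] at h1
    exact h1
  -- factor through `pointHom`
  let χ : extField k p →ₐ[RatFunc k] kollarRing k p q ⧸ Q :=
    AdjoinRoot.liftAlgHom (insepPoly k p) (Algebra.ofId (RatFunc k) (kollarRing k p q ⧸ Q))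
      (ψ (MvPolynomial.X 0)) (by
        simp only [insepPoly, eval₂_sub, eval₂_X_pow, eval₂_C, hψX]
        exact sub_self _)
  have hfac : χ.comp (pointHom k p) = ψ := by
    refine MvPolynomial.algHom_ext fun i => ?_
    fin_cases i
    · simp [χ, pointHom_X_zero, AdjoinRoot.liftAlgHom_root]
    · simp [pointHom_X_one, hψY]
  -- hence `kollarPoint ≤ Q`
  have hle : kollarPoint k p q ≤ Q := by
    rw [kollarPoint, Ideal.map_le_iff_le_comap]
    intro g hg
    have hg0 : pointHom k p g = 0 := hg
    have : ψ g = 0 := by rw [← hfac, AlgHom.comp_apply, hg0, map_zero]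
    simpa [ψ, Ideal.Quotient.eq_zero_iff_mem] using this
  exact ((kollarPoint_isMaximal k p q).eq_of_le (Ideal.IsPrime.ne_top ‹_›) hle).symm

/-- **The Kollár curve is regular (all of its local rings), for `p ∤ q`.** At the inseparable
point `𝔭 = (X^p − t, Y)` this is the barrier entry's `isRegularLocalRing_kollarPoint` (the thick
point shows `f ∉ 𝔪²`); at every other prime `Y` is a unit direction: `∂f/∂Y = qY^{q−1} ∉ 𝔮`
forces `f ∉ 𝔪_𝔮²`, and `k[X,Y]_𝔮/(f)` is regular by Matsumura 14.2. ("the only point in question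
is `(t^{1/p}, 0)`".) [cite: Kollar2007, 1.19 (Curves over nonperfect fields)] -/
theorem isRegularRing_kollarRing [CharP k p] (hpq : ¬ p ∣ q) : IsRegularRing (kollarRing k p q) := by
  rw [isRegularRing_iff]
  intro Q hQ
  by_cases hY : Ideal.Quotient.mk _ (MvPolynomial.X 1) ∈ Q
  · obtain rfl := eq_kollarPoint_of_mem k p q Q hY
    exact isRegularLocalRing_kollarPoint k p q
  · -- `Q = Q₀/(f)` with `Y ∉ Q₀`
    set Q₀ := Q.comap (Ideal.Quotient.mk (Ideal.span {kollarPoly k p q})) with hQ₀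
    have hY₀ : MvPolynomial.X 1 ∉ Q₀ := hY
    have hfQ₀ : Ideal.span {kollarPoly k p q} ≤ Q₀ := by
      rw [hQ₀, ← Ideal.map_le_iff_le_comap, Ideal.map_quotient_self]
      exact bot_le
    have hQeq : Q₀.map (Ideal.Quotient.mk (Ideal.span {kollarPoly k p q})) = Q :=
      Ideal.map_comap_of_surjective _ Ideal.Quotient.mk_surjective Q
    have key : IsRegularLocalRing (Localization.AtPrime Q₀ ⧸
        (Ideal.span {kollarPoly k p q}).map (algebraMap _ (Localization.AtPrime Q₀))) := by
      rw [Ideal.map_span, Set.image_singleton]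
      have hmem : algebraMap _ (Localization.AtPrime Q₀) (kollarPoly k p q) ∈ maximalIdeal _ := by
        rw [← Localization.AtPrime.map_eq_maximalIdeal]
        exact Ideal.mem_map_of_mem _ (hfQ₀ (Ideal.subset_span rfl))
      exact (IsRegularLocalRing.quotient_span_singleton hmem (kollarPoly_not_mem_sq k p q hpq Q₀ hY₀)).1
    haveI : (Q₀.map (Ideal.Quotient.mk (Ideal.span {kollarPoly k p q}))).IsPrime := by rw [hQeq]; exact hQ
    have h := Literature.Barriers.ResolutionOfSingularities.isRegularLocalRing_localization_map_mk (Ideal.span {kollarPoly k p q}) Q₀ hfQ₀ key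
    -- transport along the equality of primes `Q₀/(f) = Q`
    have hS : (Q₀.map (Ideal.Quotient.mk (Ideal.span {kollarPoly k p q}))).primeCompl = Q.primeCompl := by
      ext x; simp [Ideal.primeCompl, hQeq]
    haveI : IsLocalization.AtPrime
        (Localization.AtPrime (Q₀.map (Ideal.Quotient.mk (Ideal.span {kollarPoly k p q})))) Q := by
      change IsLocalization Q.primeCompl _
      rw [← hS]
      infer_instance
    exact IsRegularLocalRing.of_ringEquiv
      (R := Localization.AtPrime (Q₀.map (Ideal.Quotient.mk (Ideal.span {kollarPoly k p q}))))
      (IsLocalization.algEquiv Q.primeCompl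
        (Localization.AtPrime (Q₀.map (Ideal.Quotient.mk (Ideal.span {kollarPoly k p q}))))
        (Localization.AtPrime Q)).toRingEquiv

/-! ## §6 Dimension one; nonzero, non-unit -/

/-- `f ≠ 0`. [folklore] -/
theorem kollarPoly_ne_zero : kollarPoly k p q ≠ 0 := by
  intro h
  have := algebraMap_kollarPoly_not_mem_sq k p q
  rw [h, map_zero] at this
  exact this (Submodule.zero_mem _)

/-- `f` is not a unit (it lies in the maximal ideal `𝔮₀`). [folklore] -/
theorem not_isUnit_kollarPoly : ¬ IsUnit (kollarPoly k p q) := fun h =>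
  (pointIdeal_isMaximal k p).ne_top (Ideal.eq_top_of_isUnit_mem _ (kollarPoly_mem_pointIdeal k p q) h)

/-- **`dim k[X,Y]/(Y^q − X^p + t) = 1`** (a plane curve). [folklore] -/
theorem ringKrullDim_kollarRing : ringKrullDim (kollarRing k p q) = 1 := by
  have := Literature.AlgebraicGeometry.Motives.MvPolynomial.ringKrullDim_quotient_span_singleton
    (RatFunc k) 1 (kollarPoly_ne_zero k p q) (not_isUnit_kollarPoly k p q)
  exact_mod_cast this

end Kollar

end Summit.ResolutionOfSingularities.ResolutionOfSingularities.Theorems.CampaignW82.KollarCurveAnyField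

end
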